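import Summits.BirchSwinnertonDyer.BirchSwinnertonDyer.Theorems.CongruentShaFreeCutKatoDescentDatumOfH2
import Literature.NumberTheory.EllipticCurves.IwasawaCyclotomicProofs
import Literature.NumberTheory.EllipticCurves.BSDSelmerPConverseRationalHeegnerDescentProofs
import HarnessLib

set_option linter.dupNamespace false
set_option autoImplicit false

/-! # The v2 pin `IsKatoDescentDatumOfH2` is REALISABLE from Kato's construction facts: reading (R) of the
# Kato–zeta road ⟸ `Kato2004.nonempty_iwasawaH1Data` ∧ `Kato2004.nonempty_iwasawaH2Data` ∧ `Kato2004.thm12_4`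

Cell `bsd-cn100`, prover seat `bsd-cn100-s2-c3` (g7). Helper for stmt-BirchSwinnertonDyer-19080 (non-vacuity of
the pin over which the line `kato-zeta-perrin-riou` is proposed). THEOREMS ONLY. HONEST FRAMING: conditional
on the three displayed NAMED FACTS of bsd-smallim / bsd-cn100-ty (Kato's (12.2.1), Thm. 12.4 (1)(2) and
(14.14.1) as CONSTRUCTION statements on the pinned interfaces); nothing about Kato's Main Conjecture, crux B,
the congruent number problem or BSD is proved. No Theses import (build rule (H)). PARTITION: none — RANK axis.

## What is proved

For EVERY elliptic `W/ℚ` and EVERY prime `p`: granted `nonempty_iwasawaH1Data` (the Iwasawa cohomology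
`𝐇¹_Γ(T_pW)` exists as a `Λ`-module along the cyclotomic `ℤ_p`-extension), `nonempty_iwasawaH2Data` (Kato's
`𝐇²_Γ` descent package with (14.14.1) exists on it) and `thm12_4` (`𝐇¹_Γ` is finitely generated, torsion free
of `Λ`-rank one), there is a bsd-potss descent datum `D : KatoDescentDatum p` with `IsKatoDescentDatumOfH2 W p D`:
`D.H := 𝐇¹_Γ`, `D.z :=` ANY non-zero element (the pin leaves `z` free; `𝐇¹_Γ/Λz` is torsion because `𝐇¹_Γ` is
torsion free of rank one — `IwasawaAlgebra.isTorsion_quotient_span_singleton_of_finrank_eq_one`), `D.H2 := 𝐇²_Γ`,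
`D.A := H¹(ℤ[1/p], T_pW)`, `D.ι`, `D.π` := the package's (14.14.1), pinned by the identity maps. The cyclotomic
`ℤ_p`-extension and its topological generator come from the tree (`ZpExtension.exists_isCyclotomic_holds`,
`GaloisRep.cyclotomicCharacter_range_infinite`, surjectivity of `κ`). So the road's reading (R) — existence of a
v2-pinned datum — is these three construction facts and nothing else; its conjunction with (K) (Kato's main
conjecture for a suitable `z`, Burungale–Tian 2026 Thm. 2.6) is the registered ∃-stub `stub_readingRK`.

References: K. Kato, Astérisque 295 (2004), §12.2 (12.2.1) (p. 220), Thm. 12.4 (p. 221), §14.14 (14.14.1) (p. 243)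
[Kato2004Asterisque]; L. Washington, *Introduction to Cyclotomic Fields*, §13.1 [Washington1997]; tree:
`Kato2004/IwasawaCohomology.lean` (`nonempty_iwasawaH1Data`, `thm12_4`), `Kato2004/IwasawaH2Descent.lean`
(`nonempty_iwasawaH2Data`), `IwasawaCyclotomicProofs.lean`, `BSDSelmerPConverseRationalHeegnerDescentProofs.lean`.
-/

noncomputable section

open scoped Classical

namespace Summit.BirchSwinnertonDyer.BirchSwinnertonDyer.Theorems.CongruentShaFreeCutKatoDescentRealisable

open WeierstrassCurve Field Literature.NumberTheory.EllipticCurves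
  Literature.NumberTheory.EllipticCurves.Kato2004 Literature.NumberTheory.EllipticCurves.IwasawaAlgebra
  Literature.NumberTheory.EllipticCurves.Kato2004.EulerSystemValues
  Literature.NumberTheory.GaloisRepresentations
open Summit.BirchSwinnertonDyer.Rank1Residual.Additive (KatoDescentDatum)
open Summit.BirchSwinnertonDyer.BirchSwinnertonDyer.Theorems.CongruentShaFreeCutKatoDescentDatumOfH2

/-- **Torsion free ⟹ no zero smul-divisors over the domain `Λ = ℤ_p⟦T⟧`** (Mathlib's `Module.IsTorsionFree`
to the `NoZeroSMulDivisors` binder of bsd-potss's `KatoDescentDatum`). [folklore] -/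
theorem noZeroSMulDivisors_of_isTorsionFree {p : ℕ} [Fact p.Prime] (H : Type) [AddCommGroup H]
    [Module (IwasawaAlgebra p) H] [Module.IsTorsionFree (IwasawaAlgebra p) H] :
    NoZeroSMulDivisors (IwasawaAlgebra p) H := by
  refine ⟨fun {r m} h ↦ ?_⟩
  by_cases hr : r = 0
  · exact Or.inl hr
  · right
    have hreg : IsSMulRegular H r :=
      Module.IsTorsionFree.isSMulRegular (IsRegular.of_ne_zero hr)
    exact hreg (show r • m = r • 0 by rw [h, smul_zero])

/-- **A descent datum ON a pair of packages**: from `I : IwasawaH1Data W p κ γ` with `I.H` finitely generated,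
torsion free of rank one (the conclusions of `thm12_4`) and a descent package `J : IwasawaH2Data W p κ γ I`,
EVERY non-zero `z ∈ 𝐇¹_Γ` yields a bsd-potss datum `D` (`H := I.H`, `H2 := J.H2`, `A := J.A`, `ι := J.ι`,
`π := J.π`) together with the identity v2 pin. [cite: Kato2004Asterisque, Thm. 12.4 (p. 221) and §14.14 (14.14.1) (p. 243)] -/
theorem exists_pin_of_packages (W : WeierstrassCurve ℚ) [W.IsElliptic] (p : ℕ) [Fact p.Prime]
    [ContinuousSMul ℤ_[p] (W.tateModule p)] {κ : ZpExtension ℚ p} {γ : absoluteGaloisGroup ℚ}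
    (hκ : κ.IsCyclotomic) (hγ : κ.IsTopGenerator γ) (I : IwasawaH1Data W p κ γ)
    (hfin : Module.Finite (IwasawaAlgebra p) I.H) (htf : Module.IsTorsionFree (IwasawaAlgebra p) I.H)
    (hrk : Module.rank (IwasawaAlgebra p) I.H = 1) (J : IwasawaH2Data W p κ γ I) {z : I.H} (hz : z ≠ 0) :
    ∃ (D : KatoDescentDatum p) (_ : KatoDescentDatumPinH2 W p D), D.H = I.H := by
  haveI := hfin
  haveI := htf
  haveI : NoZeroSMulDivisors (IwasawaAlgebra p) I.H := noZeroSMulDivisors_of_isTorsionFree I.H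
  haveI := J.finite_H2
  have hfr : Module.finrank (IwasawaAlgebra p) I.H = 1 :=
    Module.finrank_eq_of_rank_eq (by rw [hrk]; rfl)
  have htor : Module.IsTorsion (IwasawaAlgebra p) (I.H ⧸ (IwasawaAlgebra p) ∙ z) :=
    IwasawaAlgebra.isTorsion_quotient_span_singleton_of_finrank_eq_one p hfr hz
  let D : KatoDescentDatum p :=
    { H := I.H, z := z, z_ne_zero := hz, isTorsion_quotient := htor,
      H2 := J.H2, isTorsion_H2 := J.isTorsion_H2, A := J.A,
      ι := J.ι, π := J.π, ι_injective := J.ι_injective, π_surjective := J.π_surjective,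
      exact_ι_π := J.exact_ι_π }
  refine ⟨D, ?_, rfl⟩
  exact
    { κ := κ, isCyclotomic := hκ, γ := γ, isTopGenerator := hγ, I := I, J := J,
      eH := LinearEquiv.refl _ _, eH2 := LinearEquiv.refl _ _, eA := LinearEquiv.refl _ _,
      eA_ι := fun _ ↦ rfl, eH2_π := fun _ ↦ rfl }

/-- **READING (R) OF THE KATO–ZETA ROAD FROM KATO'S CONSTRUCTION FACTS: the v2 pin is realisable.** For
every elliptic `W/ℚ` and every prime `p`, granted bsd-smallim's `Kato2004.nonempty_iwasawaH1Data` and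
`Kato2004.thm12_4` [Kato (12.2.1), Thm. 12.4 (2)] and bsd-cn100-ty's `Kato2004.nonempty_iwasawaH2Data` [Kato Thm.
12.4 (1), (14.14.1)], some `D : KatoDescentDatum p` satisfies `IsKatoDescentDatumOfH2 W p D`. The cyclotomic
`ℤ_p`-extension is the tree's (`ZpExtension.exists_isCyclotomic_holds`), its topological generator any preimage of
`1 ∈ ℤ_p`; `z` is any non-zero element of `𝐇¹_Γ` (non-trivial, being of rank one). CONDITIONAL on the three named
facts; proves nothing about the main conjecture or BSD. [cite: Kato2004Asterisque, §12.2 (12.2.1) (p. 220), Thm. 12.4 (p. 221), §14.14 (14.14.1) (p. 243)]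
[cite: Washington1997, §13.1 (p. 264)] -/
theorem exists_isKatoDescentDatumOfH2 (h1 : nonempty_iwasawaH1Data) (h2 : nonempty_iwasawaH2Data)
    (h12 : thm12_4) (W : WeierstrassCurve ℚ) [W.IsElliptic] (p : ℕ) [Fact p.Prime] :
    ∃ D : KatoDescentDatum p, IsKatoDescentDatumOfH2 W p D := by
  letI : ContinuousSMul ℤ_[p] (W.tateModule p) := TateModule.continuousSMul_padicInt
  obtain ⟨κ, hκ⟩ := ZpExtension.exists_isCyclotomic_holds ℚ p
    (GaloisRep.cyclotomicCharacter_range_infinite ℚ p)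
  obtain ⟨γ, hγ⟩ := κ.surjective (Multiplicative.ofAdd 1)
  have hγ' : κ.IsTopGenerator γ := hγ
  obtain ⟨I⟩ := h1 W p κ γ hκ hγ'
  obtain ⟨hfin, ⟨htf, hrk⟩, -⟩ := h12 W p κ γ hκ hγ' I
  obtain ⟨J⟩ := h2 W p κ γ hκ hγ' I
  haveI := htf
  haveI : NoZeroSMulDivisors (IwasawaAlgebra p) I.H := noZeroSMulDivisors_of_isTorsionFree I.H
  obtain ⟨z, hz⟩ : ∃ z : I.H, z ≠ 0 := rank_pos_iff_exists_ne_zero.mp (by rw [hrk]; exact zero_lt_one)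
  obtain ⟨D, pin, -⟩ := exists_pin_of_packages W p hκ hγ' I hfin htf hrk J hz
  exact ⟨D, isKatoDescentDatumOfH2_of_pin pin⟩

end Summit.BirchSwinnertonDyer.BirchSwinnertonDyer.Theorems.CongruentShaFreeCutKatoDescentRealisable

end
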